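import Summits.Ventures.HSemireg.GeneralStructureWiringBlochCharted
import Summits.Ventures.HSemireg.GeneralStructureWiringBlochFamilies
import Summits.Ventures.HSemireg.GeneralStructureWiring
import Summits.Ventures.HSemireg.GeneralStructureWiringFamilies
import Literature.AlgebraicGeometry.Motives.AbelianFibresOfAbelianFibre
import Literature.AlgebraicGeometry.Motives.AlgPointsNonempty
import HarnessLib

/-!
# HSemireg venture · general structure (G4) — the WIRING, SQUARES: «(∀- or ∃-form) ∧ HC_CM ∧ Deligne [∧ Catanese] ⟹ witness form (F2) ⟹ HC_AV», both sides

HONEST FRAMING (speculative tier of cell `pub-hsemireg`, team «general structure», seat G4; verbatim the cell's wording rule):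
**nothing here says `HC_AV` or `HC_CM` is proved; every implication carries its named hypotheses.** No `sorry`, one new `@[conjecture] def`
((F1)-cycle, §3), no new axiom; axioms `propext`, `Classical.choice`, `Quot.sound`. `HC_CM` = `Theses.RankFourFaces.CMAbelianHodge` (stmt-3052, binder); `HC_AV` =
`Theses.PadicSemiregularLift.HodgeAbelianVarieties` (stmt-1333).

The cycle-side analogue of `GeneralStructureWiringFamilies.lean`'s `HC_CM ∧ CMDense ∧ (F1) ⟹ (F2)`: it shows EXACTLY where `HC_CM` is consumed on
the cycle rows, and why the CHARTED witness form (`BlochPresentedChartedFamilies`, model `X₀` of the fibre) is the right one — the ∀-form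
`UniformBlochLiftAtCM` hands its cycle on the CM MODEL `A₀.X`, which is only isomorphic to the scheme-theoretic fibre.

* SQ-1 `blochPresentedChartedFamilies_of_hc_cm_of_cmAnchoredFamilies_of_catanese_of_uniformBlochLift`:
  `HC_CM ∧ CMAnchoredFamilies ∧ [Catanese 2002] ∧ UniformBlochLiftAtCM ⟹ BlochPresentedChartedFamilies` — Deligne's packaging gives the family
  through `A` with its CM fibre `A₀ ≅ 𝒳_{s₀}`; `HC_CM` (by name, via `CMPivot.hodgeCM_of_cmAbelianHodge`) makes `G|_{A₀}` algebraic; the ∀-form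
  returns the correction `H` and the cycle `Z ↪ A₀.X`; Catanese's theorem (every fibre abelian) turns «Hodge on abelian-presented fibres» into
  «Hodge on every fibre»; the witness is `(f, G, t, s₀, H, X₀ := A₀.X, e₀ := the chart, Z)`.
* SQ-2 `blochPresentedChartedFamilies_of_blochPresentedFamilies` — the un-charted witness form is the case `X₀ = 𝒳_{s₀}`, `e₀ = Iso.refl`.
* SQ-3 the square closes: L1-cycle re-derived as SQ-1 followed by BC-1 (`hc_av_of_blochSpread_of_blochPresentedChartedFamilies`), i.e.
  `HC_CM ∧ CMAnchoredFamilies ∧ Catanese ∧ UniformBlochLiftAtCM ∧ Bloch 7.4 ⟹ HC_AV` through the witness form — same hypotheses as the landed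
  row B-2 of `GeneralStructureWiringBloch.lean`, different route (position only; no new content).
* SQ-4 / SQ-5 (SHEAF side, no Catanese needed — the presentation lives on the scheme-theoretic fibre and carries its own horizontality):
  `HC_CM ∧ CMAnchoredFamilies ∧ UniformSemiregularSheafLiftAtCM C ⟹ SemiregularPresentedFamilies C` and
  `HC_CM ∧ CMAnchoredFamilies ∧ ExistsSemiregularSheafCMAnchor C ⟹ SemiregularPresentedFamilies C`; SQ-6 row L1 re-derived through (F2).
  UPSHOT (honest column, both sides, in the kernel): the ENTIRE role of `HC_CM` and of Deligne's CM anchors on the `HC_CM`-load-bearing rows is to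
  turn the team's ∀/∃-form into an (F2)-witness; (F2) ∧ the transfer fact ⟹ `HC_AV` is Bloch's 1972 reduction.
* §3 (F1)-CYCLE `ExistsBlochCMAnchorDense` — the cycle-side CM-DENSE form (∀ over Deligne's dense Mumford–Tate families, ∃ a CM fibre with a
  MODEL chart carrying the correction `H` and, unless `(W - H)` vanishes there, one integral Bloch-semiregular lci): SQ-7 `UniformBlochLiftAtCM ⟹`
  it (pick any CM fibre by density; the ∀-form's own model `A₀.X` is the chart); SQ-8 `HC_CM ∧ CMDenseMumfordTateFamilies ∧ (F1)-cycle ⟹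
  BlochPresentedChartedFamilies`; SQ-9 **`HC_CM ∧ [Deligne 1982, dense form] ∧ [Bloch 7.4] ∧ UniformBlochLiftAtCM ⟹ HC_AV` WITHOUT Catanese** —
  one printed fact FEWER than the landed row B-2 (the dense Deligne typing carries the fibrewise Hodge clause on every fibre, so «deformations
  of abelian varieties are abelian» is not needed on this path).

## References (bib keys)

Bloch1972Semiregularity (Thm. 7.4, Remark 7.5), Deligne1982HodgeCycles (Prop. 6.1), Catanese2002DeformationTypes (§4 Thm. 4.1, 4.6),
CharlesSchnell2014Notes (Prop. 11.3.11, Thm. 11.5.11), MumfordAV1970 (§22).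
-/

noncomputable section

open CategoryTheory
open Literature.AlgebraicGeometry Literature.AlgebraicGeometry.Motives
open Literature.AlgebraicGeometry.HodgeTheory
open Literature.AlgebraicGeometry.Deligne1982 (deligne1982_cmDenseMumfordTateFamilies)

namespace Summit.Ventures.HSemireg.GeneralStructure

open Summit.HodgeConjecture.HodgeConjecture
open Summit.HodgeConjecture.HodgeConjecture.Ring2.Hypotheses (CMAnchoredFamilies)
open Summit.HodgeConjecture.HodgeConjecture.Ring2.Deform (cmLocus CMDenseMumfordTateFamilies cmDenseMumfordTateFamilies_of_deligne1982)
open Summit.HodgeConjecture.HodgeConjecture.Ring2Transport (HodgeWeilType hodgeAbelianVarieties_iff_hodgeWeilType mem_algebraicClasses_of_cmChart)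
open Summit.HodgeConjecture.HodgeConjecture.Theorems.HodgeAbelianVarieties.CMPivot (isCM_iff_exists_cmSubalgebra)
open Literature.AlgebraicGeometry.Milne1999 (IsOfCMType)
open Summit.HodgeConjecture.HodgeConjecture.Theorems.HodgeAbelianVarieties.CMPivot (hodgeCM_of_cmAbelianHodge)

/-! ### §1 The cycle-side square (model chart, Catanese) -/

/-- **SQ-1 — `HC_CM ∧ CMAnchoredFamilies ∧ [Catanese 2002] ∧ UniformBlochLiftAtCM ⟹ BlochPresentedChartedFamilies`** (kernel-checked; where
`HC_CM` is consumed on the cycle side). Given `(A, c)`: Deligne's CM-anchored family `(f, G, t, s₀, A₀, e₀)`; `HC_CM` ⟹ `G|_{A₀}` algebraic;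
the ∀-form ⟹ `H` and (`(G - H)|_{A₀} = 0` or a Bloch-semiregular lci `Z ↪ A₀.X` supporting `e₀^*(G - H)`); Catanese ⟹ `G` rational `(p,p)` on
every fibre; the witness takes the MODEL `X₀ := A₀.X` with the chart `A₀.X ≅ 𝒳_{s₀}` underlying `e₀`. [cite: Deligne1982HodgeCycles, Prop. 6.1]
[cite: Catanese2002DeformationTypes, §4 Thm. 4.1 and Thm. 4.6] [cite: MumfordAV1970, §22] [cite: Bloch1972Semiregularity, Remark (7.5)] -/
theorem blochPresentedChartedFamilies_of_hc_cm_of_cmAnchoredFamilies_of_catanese_of_uniformBlochLift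
    (hCM : Theses.RankFourFaces.CMAbelianHodge) (hMT : CMAnchoredFamilies) (hC : catanese2002_abelianFibres_of_abelianFibre)
    (hL : UniformBlochLiftAtCM) : BlochPresentedChartedFamilies := by
  intro A p c hc hh
  obtain ⟨S, 𝒳, f, G, t, s₀, e, A₀, e₀, h𝒳, hS, hsm, hirr, hf, hAt, hA₀, hcm, hGc, hG⟩ := hMT A p c hc hh
  -- `HC_CM` at the CM fibre
  have h₀ := hG A₀ e₀ s₀ hA₀
  have halg : HodgeTheory.complexBetti.map e₀ (2 * p) G ∈ HodgeTheory.algebraicClasses A₀.X p :=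
    (hodgeCM_of_cmAbelianHodge hCM A₀ hcm).2 p _ h₀.1 h₀.2
  -- the ∀-form at that fibre
  obtain ⟨H, hH, hcase⟩ := hL S 𝒳 f A.dim p G s₀ A₀ e₀ h𝒳 hS hsm hirr hf hA₀ hcm halg hG
  obtain ⟨i₀, hi₀⟩ := hA₀
  obtain ⟨i, hi⟩ := hAt
  have hq𝒳 : IsQuasiProjectiveOver 𝒳 := h𝒳
  have hqS : IsQuasiProjectiveOver S := hS
  -- every fibre is abelian (Catanese), so `G` is rational `(p,p)` on every fibre
  have hdim : A₀.dim = A.dim := schemeDim_eq_holds ((hf.isSmoothProjective s₀).of_iso i₀.symm)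
  have hfam : IsSmoothProjectiveFamily f A₀.dim := hdim ▸ hf
  have hW : ∀ s : ComplexPoints S,
      IsRationalClass (complexBetti.map (fiberι f s) (2 * p) G) ∧
        IsOfHodgeType A.dim (fiberOver f s) (2 * p) p p (complexBetti.map (fiberι f s) (2 * p) G) := by
    intro s
    obtain ⟨B, -, ⟨iB⟩⟩ := hC f A₀ hq𝒳 hqS hirr hsm hfam ⟨s₀, ⟨i₀⟩⟩ s
    have h := hG B (iB.hom ≫ fiberι f s) s ⟨iB, rfl⟩
    have he : HodgeTheory.complexBetti.map (iB.hom ≫ fiberι f s) (2 * p) G =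
        complexBetti.map iB.hom (2 * p) (complexBetti.map (fiberι f s) (2 * p) G) := by
      rw [complexBetti.map_comp]
      rfl
    rw [he] at h
    have hBdim : B.dim = A.dim := schemeDim_eq_holds ((hf.isSmoothProjective s).of_iso iB.symm)
    exact ⟨(isRationalClass_map_iff_of_iso iB).1 h.1, hBdim ▸ (isOfHodgeType_map_iff_of_iso iB).1 h.2⟩
  -- the chart at `t` returns `c`
  have hGc' : HodgeTheory.complexBetti.map i.hom (2 * p) (HodgeTheory.complexBetti.map (fiberι f t) (2 * p) G) = c := by
    rw [← hGc, hi, complexBetti.map_comp]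
    rfl
  -- the supported class, read through the chart `i₀`
  have he₀ : complexBetti.map i₀.hom (2 * p) (complexBetti.map (fiberι f s₀) (2 * p) (G - H)) =
      complexBetti.map e₀ (2 * p) (G - H) := by
    rw [hi₀, complexBetti.map_comp]
    rfl
  refine ⟨𝒳, S, f, t, i, G, hf, h𝒳, hS, hirr, hsm, hW, hGc', s₀, H, A₀.X, i₀, hH, ?_⟩
  rcases hcase with h0 | ⟨Z, j, hcj, hreg, hint, hcoh, hsr, hsupp⟩
  · left
    apply (complexBetti.bijective_map_of_iso i₀ (2 * p)).1
    rw [he₀, h0, map_zero]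
  · right
    refine ⟨Z, j, hcj, hreg, hint, hcoh, hsr, ?_⟩
    rw [he₀]
    exact hsupp

/-- **SQ-2 — the un-charted witness form is a case of the charted one** (`X₀ = 𝒳_{s₀}`, `e₀ = Iso.refl`). [cite: Bloch1972Semiregularity, Thm. (7.4)] -/
theorem blochPresentedChartedFamilies_of_blochPresentedFamilies (h : BlochPresentedFamilies) : BlochPresentedChartedFamilies := by
  intro A p c hc hh
  obtain ⟨𝒳, S, f, s₁, e, W, hf, h𝒳, hS, hirr, hsm, hW, hWc, s₀, H, hH, hcase⟩ := h A p c hc hh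
  refine ⟨𝒳, S, f, s₁, e, W, hf, h𝒳, hS, hirr, hsm, hW, hWc, s₀, H, fiberOver f s₀, Iso.refl _, hH, ?_⟩
  rcases hcase with h0 | ⟨Z, i, hci, hreg, hint, hcoh, hsr, hsupp⟩
  · exact Or.inl h0
  · refine Or.inr ⟨Z, i, hci, hreg, hint, hcoh, hsr, ?_⟩
    rw [Iso.refl_hom, complexBetti.map_id]
    exact hsupp

/-- **SQ-3 — the square closes: row B-2 of `GeneralStructureWiringBloch.lean` re-derived THROUGH the witness form** (same hypotheses,
different route: ∀-form ∧ `HC_CM` ∧ anchors ∧ Catanese ⟹ charted witnesses ⟹ `HC_AV` by Bloch 7.4). Position only; no new content.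
[cite: Bloch1972Semiregularity, Thm. (7.4)] [cite: Deligne1982HodgeCycles, Prop. 6.1] [cite: Catanese2002DeformationTypes, §4 Thm. 4.1] -/
theorem hc_av_of_hc_cm_of_cmAnchoredFamilies_of_catanese_of_uniformBlochLift_via_witnesses
    (hCM : Theses.RankFourFaces.CMAbelianHodge) (hMT : CMAnchoredFamilies) (hC : catanese2002_abelianFibres_of_abelianFibre)
    (hB : ∀ m p : ℕ, BlochSemiregularSpread m p) (hL : UniformBlochLiftAtCM) : Theses.PadicSemiregularLift.HodgeAbelianVarieties :=
  hc_av_of_blochSpread_of_blochPresentedChartedFamilies hB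
    (blochPresentedChartedFamilies_of_hc_cm_of_cmAnchoredFamilies_of_catanese_of_uniformBlochLift hCM hMT hC hL)


/-! ### §2 The sheaf-side squares (no Catanese) -/

/-- **SQ-4 — `HC_CM ∧ CMAnchoredFamilies ∧ UniformSemiregularSheafLiftAtCM C ⟹ SemiregularPresentedFamilies C`** (kernel-checked; where `HC_CM`
is consumed on the sheaf side): Deligne's CM-anchored family through `(A, c)`, `HC_CM` at its CM fibre, the ∀-form's presentation at that fibre
— the presentation lives on the scheme-theoretic fibre `𝒳_{s₀}` and carries its own horizontality clause, so no abelian-fibres input is needed.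
[cite: Deligne1982HodgeCycles, Prop. 6.1] [cite: BuchweitzFlenner2003, §5 Thm. 5.1] [cite: MumfordAV1970, §22] -/
theorem semiregularPresentedFamilies_of_hc_cm_of_cmAnchoredFamilies_of_uniformSheafLift (C : ChernCharacterBetti)
    (hCM : Theses.RankFourFaces.CMAbelianHodge) (hMT : CMAnchoredFamilies) (hL : UniformSemiregularSheafLiftAtCM C) :
    SemiregularPresentedFamilies C := by
  intro A p c hc hh
  obtain ⟨S, 𝒳, f, G, t, s₀, e, A₀, e₀, h𝒳, hS, hsm, hirr, hf, hAt, hA₀, hcm, hGc, hG⟩ := hMT A p c hc hh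
  have h₀ := hG A₀ e₀ s₀ hA₀
  have halg : HodgeTheory.complexBetti.map e₀ (2 * p) G ∈ HodgeTheory.algebraicClasses A₀.X p :=
    (hodgeCM_of_cmAbelianHodge hCM A₀ hcm).2 p _ h₀.1 h₀.2
  have hlift := hL S 𝒳 f A.dim p G s₀ A₀ e₀ h𝒳 hS hsm hirr hf hA₀ hcm halg hG
  obtain ⟨i, hi⟩ := hAt
  have hGc' : HodgeTheory.complexBetti.map i.hom (2 * p) (HodgeTheory.complexBetti.map (fiberι f t) (2 * p) G) = c := by
    rw [← hGc, hi, complexBetti.map_comp]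
    rfl
  exact ⟨𝒳, S, f, t, i, G, s₀, hf, h𝒳, hS, hirr, hsm, hGc', hlift⟩

/-- **SQ-5 — `HC_CM ∧ CMAnchoredFamilies ∧ ExistsSemiregularSheafCMAnchor C ⟹ SemiregularPresentedFamilies C`** (the ∃-form's square; `HC_CM`
makes `G` algebraic at EVERY CM-presented fibre, the ∃-form picks the presented one). [cite: Deligne1982HodgeCycles, Prop. 6.1]
[cite: BuchweitzFlenner2003, §5 Thm. 5.1] [cite: MumfordAV1970, §22] -/
theorem semiregularPresentedFamilies_of_hc_cm_of_cmAnchoredFamilies_of_existsAnchor (C : ChernCharacterBetti)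
    (hCM : Theses.RankFourFaces.CMAbelianHodge) (hMT : CMAnchoredFamilies) (hL : ExistsSemiregularSheafCMAnchor C) :
    SemiregularPresentedFamilies C := by
  intro A p c hc hh
  obtain ⟨S, 𝒳, f, G, t, s₀, e, A₀, e₀, h𝒳, hS, hsm, hirr, hf, hAt, hA₀, hcm, hGc, hG⟩ := hMT A p c hc hh
  have halgCM : ∀ (s : ComplexPoints S) (A' : AbelianVariety ℂ) (e' : A'.X ⟶ 𝒳),
      (∃ i' : A'.X ≅ fiberOver f s, e' = i'.hom ≫ fiberι f s) →
      (∃ (ψ : A' ⟶ A') (μ : Fin (2 * AbelianVariety.dim A') → ℂ), Function.Injective μ ∧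
        ∀ j, Module.End.HasEigenvalue (HodgeTheory.complexBetti.map ψ.hom.hom.hom 1).hom (μ j)) →
      HodgeTheory.complexBetti.map e' (2 * p) G ∈ HodgeTheory.algebraicClasses A'.X p := by
    intro s A' e' he' hcm'
    have hH := hG A' e' s he'
    exact (hodgeCM_of_cmAbelianHodge hCM A' hcm').2 p _ hH.1 hH.2
  obtain ⟨s₁, A₁, e₁, -, -, hlift⟩ := hL S 𝒳 f A.dim p G h𝒳 hS hsm hirr hf hG ⟨s₀, A₀, e₀, hA₀, hcm⟩ halgCM
  obtain ⟨i, hi⟩ := hAt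
  have hGc' : HodgeTheory.complexBetti.map i.hom (2 * p) (HodgeTheory.complexBetti.map (fiberι f t) (2 * p) G) = c := by
    rw [← hGc, hi, complexBetti.map_comp]
    rfl
  exact ⟨𝒳, S, f, t, i, G, s₁, hf, h𝒳, hS, hirr, hsm, hGc', hlift⟩

/-- **SQ-6 — row L1 of `GeneralStructureWiring.lean` re-derived THROUGH (F2)**: `HC_CM ∧ CMAnchoredFamilies ∧ [BF 5.1] ∧ ∀-form ⟹ (F2) ⟹ HC_AV`
(same hypotheses as the landed G4-2, different route; position only). [cite: Bloch1972Semiregularity, Introduction p. 51]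
[cite: BuchweitzFlenner2003, §5 Thm. 5.1] [cite: Deligne1982HodgeCycles, Prop. 6.1] -/
theorem hc_av_of_hc_cm_of_cmAnchoredFamilies_of_buchweitzFlenner_of_uniformSheafLift_via_witnesses (C : ChernCharacterBetti)
    (hCM : Theses.RankFourFaces.CMAbelianHodge) (hMT : CMAnchoredFamilies) (hBF : BuchweitzFlenner2003_variationalHodge_ISemiregular)
    (hL : UniformSemiregularSheafLiftAtCM C) : Theses.PadicSemiregularLift.HodgeAbelianVarieties :=
  hc_av_of_buchweitzFlenner_of_semiregularPresentedFamilies C hBF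
    (semiregularPresentedFamilies_of_hc_cm_of_cmAnchoredFamilies_of_uniformSheafLift C hCM hMT hL)

/-- **SQUARES POSITION** (conjunction): on BOTH sides the `HC_CM`-load-bearing forms factor through the witness forms given `HC_CM` and the CM
anchors (plus Catanese on the cycle side), and the witness forms give `HC_AV` with the transfer fact alone. [cite: Bloch1972Semiregularity, Introduction p. 51]
[cite: Deligne1982HodgeCycles, Prop. 6.1] -/
theorem squares_position (C : ChernCharacterBetti) :
    (Theses.RankFourFaces.CMAbelianHodge → CMAnchoredFamilies → UniformSemiregularSheafLiftAtCM C → SemiregularPresentedFamilies C) ∧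
    (Theses.RankFourFaces.CMAbelianHodge → CMAnchoredFamilies → ExistsSemiregularSheafCMAnchor C → SemiregularPresentedFamilies C) ∧
    (BuchweitzFlenner2003_variationalHodge_ISemiregular → SemiregularPresentedFamilies C →
      Theses.PadicSemiregularLift.HodgeAbelianVarieties) ∧
    (Theses.RankFourFaces.CMAbelianHodge → CMAnchoredFamilies → catanese2002_abelianFibres_of_abelianFibre → UniformBlochLiftAtCM →
      BlochPresentedChartedFamilies) ∧
    ((∀ m p : ℕ, BlochSemiregularSpread m p) → BlochPresentedChartedFamilies → Theses.PadicSemiregularLift.HodgeAbelianVarieties) :=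
  ⟨semiregularPresentedFamilies_of_hc_cm_of_cmAnchoredFamilies_of_uniformSheafLift C,
    semiregularPresentedFamilies_of_hc_cm_of_cmAnchoredFamilies_of_existsAnchor C,
    hc_av_of_buchweitzFlenner_of_semiregularPresentedFamilies C,
    blochPresentedChartedFamilies_of_hc_cm_of_cmAnchoredFamilies_of_catanese_of_uniformBlochLift,
    hc_av_of_blochSpread_of_blochPresentedChartedFamilies⟩


/-! ### §3 The cycle-side CM-DENSE form and the Catanese-free row -/

/-- `QProj[X]` — `X` quasi-projective over `ℂ` (inlined body of `HodgeTheory.IsQuasiProjectiveOver X`). Local notation only. -/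
local notation3 (prettyPrint := false) "QProj[" X "]" =>
  ∃ (P : SchemeOver ℂ) (j : X ⟶ P), IsProjectiveOver P ∧ AlgebraicGeometry.IsOpenImmersion j.left

/-- **(F1)-cycle `ExistsBlochCMAnchorDense` — ONE BLOCH-PRESENTED CM FIBRE PER CM-DENSE FAMILY, cycle form with a MODEL chart** (OURS, SPECULATIVE,
OPEN — NOT a Literature fact). In the typing of Deligne's dense Mumford–Tate families (ring 2's `Ring2.Deform.CMDenseMumfordTateFamilies`: smooth
projective `f : 𝒳 ⟶ S` of relative dimension `n`, `𝒳`, `S` quasi-projective, `S` smooth irreducible, abelian charts at every fibre, `W` fibrewise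
rational `(p,p)`, `cmLocus f n` dense): IF `W` is algebraic at every CM fibre (what `HC_CM` delivers) THEN some CM fibre `s₁`, with a MODEL
`e₀ : X₀ ≅ 𝒳_{s₁}` and a global class `H` rational and algebraic on every fibre, has `(W - H)|_{𝒳_{s₁}} = 0` or an integral Bloch-semiregular lci
`Z ↪ X₀` of codimension `p` supporting `e₀^*((W - H)|_{𝒳_{s₁}})` (verbatim the binders of `BlochSemiregularSpread n p`). Implied by the ∀-form
`UniformBlochLiftAtCM` (SQ-7); the weakest `HC_CM`-load-bearing cycle form. POSITION (RED-GS GS-14, revised 2026-08-22, kernel: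
`existsBlochCMAnchorDense_of_hc_av` below and `uniformBlochLift_sandwich` in `GeneralStructureWiringConverses.lean`): IMPLIED by `HC_AV` (the free
correction `H := W` on any family whose fibres are abelian varieties), hence a CASE of the summit sitting between `CMToAbelian` and `HC_AV`; its
content is the transport of algebraicity from a CM fibre, a semiregular representative being a proof strategy for an instance; the referee
label «plausibly false as a `∀`» does NOT apply (it is kept for the SHEAF forms only); NO deformation-free shadow
(`blochLift_conclusion_of_fibrewise_algebraic`). NOT asserted. [cite: Bloch1972Semiregularity, Thm. (7.4) and Remark (7.5)]
[cite: Deligne1982HodgeCycles, Prop. 6.1 and §6 pp. 59–61] [status: open] -/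
@[conjecture] def ExistsBlochCMAnchorDense : Prop :=
  ∀ (𝒳 S : SchemeOver ℂ) (f : 𝒳 ⟶ S) (n p : ℕ) (W : HodgeTheory.complexBetti 𝒳 (2 * p)),
    IsSmoothProjectiveFamily f n → QProj[𝒳] → QProj[S] → IrreducibleSpace S.left → AlgebraicGeometry.Smooth S.hom →
    (∀ s : ComplexPoints S, ∃ A' : AbelianVariety ℂ, A'.dim = n ∧ Nonempty (A'.X ≅ fiberOver f s)) →
    (∀ s : ComplexPoints S, HodgeTheory.IsRationalClass (HodgeTheory.complexBetti.map (fiberι f s) (2 * p) W) ∧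
      HodgeTheory.IsOfHodgeType n (fiberOver f s) (2 * p) p p (HodgeTheory.complexBetti.map (fiberι f s) (2 * p) W)) →
    Dense (cmLocus f n) →
    (∀ s ∈ cmLocus f n, HodgeTheory.complexBetti.map (fiberι f s) (2 * p) W ∈ HodgeTheory.algebraicClasses (fiberOver f s) p) →
    ∃ s₁ ∈ cmLocus f n, ∃ (H : HodgeTheory.complexBetti 𝒳 (2 * p)) (X₀ : SchemeOver ℂ) (e₀ : X₀ ≅ fiberOver f s₁),
      (∀ t : ComplexPoints S, IsRationalClass (complexBetti.map (fiberι f t) (2 * p) H) ∧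
        complexBetti.map (fiberι f t) (2 * p) H ∈ algebraicClasses (fiberOver f t) p) ∧
      (complexBetti.map (fiberι f s₁) (2 * p) (W - H) = 0 ∨
        ∃ (Z : AlgebraicGeometry.Scheme.{0}) (i : Z ⟶ X₀.left),
          AlgebraicGeometry.IsClosedImmersion i ∧ IsRegularImmersionOfCodim i p ∧
          AlgebraicGeometry.IsIntegral Z ∧ (∀ z ∈ Set.range i.base, (p : ℕ∞) ≤ Order.coheight z) ∧
          IsBlochSemiregular i n p ∧
          complexBetti.map e₀.hom (2 * p) (complexBetti.map (fiberι f s₁) (2 * p) (W - H)) ∈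
            classesSupportedOn X₀ (Set.range i.base) (2 * p))

/-- **SQ-7 — the ∀-form gives (F1)-cycle**: pick ANY CM fibre `s₀` by density (Milne's `IsOfCMType` ↔ the eigenvalue typing,
`CMPivot.isCM_iff_exists_cmSubalgebra`), read the dense family's clauses in the ∀-form's typing through the abelian charts, apply
`UniformBlochLiftAtCM` there; its model `A₀.X` with the chart `A₀.X ≅ 𝒳_{s₀}` is the witness chart. [cite: MumfordAV1970, §22] [cite: Deligne1982HodgeCycles, §6 p. 61] -/
theorem existsBlochDense_of_uniformBlochLift (hL : UniformBlochLiftAtCM) : ExistsBlochCMAnchorDense := by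
  intro 𝒳 S f n p W hf hq𝒳 hqS hirr hsm hab hW hD halg
  haveI := hsm
  haveI := hirr
  haveI : Nonempty (ComplexPoints S) := ComplexPoints_nonempty_of_smooth S
  obtain ⟨s₀, A₀, ⟨e₀⟩, hdim₀, hcm₀⟩ := hD.nonempty
  have hs₀ : s₀ ∈ cmLocus f n := ⟨A₀, ⟨e₀⟩, hdim₀, hcm₀⟩
  have hG : ∀ (B : AbelianVariety ℂ) (eB : B.X ⟶ 𝒳) (u : ComplexPoints S),
      (∃ iB : B.X ≅ fiberOver f u, eB = iB.hom ≫ fiberι f u) →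
        IsRationalClass (complexBetti.map eB (2 * p) W) ∧ IsOfHodgeType B.dim B.X (2 * p) p p (complexBetti.map eB (2 * p) W) := by
    rintro B eB u ⟨iB, hiB⟩
    have hBdim : B.dim = n := schemeDim_eq_holds ((hf.isSmoothProjective u).of_iso iB.symm)
    have he : HodgeTheory.complexBetti.map eB (2 * p) W =
        complexBetti.map iB.hom (2 * p) (complexBetti.map (fiberι f u) (2 * p) W) := by
      rw [hiB, complexBetti.map_comp]
      rfl
    rw [he, hBdim]
    exact ⟨(isRationalClass_map_iff_of_iso iB).2 (hW u).1, (isOfHodgeType_map_iff_of_iso iB).2 (hW u).2⟩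
  have he₀ : complexBetti.map (e₀.hom ≫ fiberι f s₀) (2 * p) W =
      complexBetti.map e₀.hom (2 * p) (complexBetti.map (fiberι f s₀) (2 * p) W) := by
    rw [complexBetti.map_comp]
    rfl
  have halg₀ : complexBetti.map (e₀.hom ≫ fiberι f s₀) (2 * p) W ∈ algebraicClasses A₀.X p := by
    rw [he₀]
    exact (mem_algebraicClasses_map_iff_of_iso e₀).2 (halg s₀ hs₀)
  obtain ⟨H, hH, hcase⟩ := hL S 𝒳 f n p W s₀ A₀ (e₀.hom ≫ fiberι f s₀) hq𝒳 hqS hsm hirr hf ⟨e₀, rfl⟩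
    ((isCM_iff_exists_cmSubalgebra A₀).2 hcm₀) halg₀ hG
  have he₀' : complexBetti.map e₀.hom (2 * p) (complexBetti.map (fiberι f s₀) (2 * p) (W - H)) =
      complexBetti.map (e₀.hom ≫ fiberι f s₀) (2 * p) (W - H) := by
    rw [complexBetti.map_comp]
    rfl
  refine ⟨s₀, hs₀, H, A₀.X, e₀, hH, ?_⟩
  rcases hcase with h0 | ⟨Z, i, hci, hreg, hint, hcoh, hsr, hsupp⟩
  · left
    apply (complexBetti.bijective_map_of_iso e₀ (2 * p)).1
    rw [he₀', h0, map_zero]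
  · right
    refine ⟨Z, i, hci, hreg, hint, hcoh, hsr, ?_⟩
    rw [he₀']
    exact hsupp

/-- **SQ-8 — `HC_CM ∧ CMDenseMumfordTateFamilies ∧ (F1)-cycle ⟹ BlochPresentedChartedFamilies`** (where `HC_CM` is consumed on the dense cycle
path): Deligne's dense family of `(A, c)`; `HC_CM` at every CM fibre (`Ring2Transport.mem_algebraicClasses_of_cmChart`); (F1)-cycle picks the
presented fibre with its model; that is the charted witness. [cite: Deligne1982HodgeCycles, Prop. 6.1] [cite: CharlesSchnell2014Notes, Thm. 11.5.11]
[cite: Milne1999, §2 p. 54] -/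
theorem blochPresentedChartedFamilies_of_hc_cm_of_cmDense_of_existsBlochDense (hCM : Theses.RankFourFaces.CMAbelianHodge)
    (hMT : CMDenseMumfordTateFamilies) (hL : ExistsBlochCMAnchorDense) : BlochPresentedChartedFamilies := by
  intro A p c hc hh
  obtain ⟨𝒳, S, f, s₁, e, W, hf, hq𝒳, hqS, hirr, hsm, hab, hW, hWc, hD⟩ :=
    hMT A AbelianVariety.isSmoothProjective_holds p c hc hh
  have halgCM : ∀ s ∈ cmLocus f A.dim,
      HodgeTheory.complexBetti.map (fiberι f s) (2 * p) W ∈ HodgeTheory.algebraicClasses (fiberOver f s) p := by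
    rintro s ⟨A₀, ⟨e₀⟩, hdim₀, hcm₀⟩
    exact mem_algebraicClasses_of_cmChart hCM A₀ e₀ hdim₀ hcm₀ (hW s).1 (hW s).2
  obtain ⟨s₀, -, H, X₀, e₀, hH, hcase⟩ := hL 𝒳 S f A.dim p W hf hq𝒳 hqS hirr hsm hab hW hD halgCM
  exact ⟨𝒳, S, f, s₁, e, W, hf, hq𝒳, hqS, hirr, hsm, hW, hWc, s₀, H, X₀, e₀, hH, hcase⟩

/-- **SQ-9 — `HC_CM ∧ [Deligne 1982, dense form] ∧ [Bloch 7.4] ∧ UniformBlochLiftAtCM ⟹ HC_AV`, WITHOUT Catanese** (kernel-checked: SQ-7, SQ-8, BC-1;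
one printed fact fewer than the landed row B-2 of `GeneralStructureWiringBloch.lean`). [cite: Deligne1982HodgeCycles, Prop. 6.1]
[cite: CharlesSchnell2014Notes, Thm. 11.5.11 and Prop. 11.3.11 (proof)] [cite: Bloch1972Semiregularity, Thm. (7.4)] -/
theorem hc_av_of_hc_cm_of_deligne1982_of_blochSpread_of_uniformBlochLift (hCM : Theses.RankFourFaces.CMAbelianHodge)
    (hD : deligne1982_cmDenseMumfordTateFamilies) (hB : ∀ m p : ℕ, BlochSemiregularSpread m p) (hL : UniformBlochLiftAtCM) :
    Theses.PadicSemiregularLift.HodgeAbelianVarieties :=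
  hc_av_of_blochSpread_of_blochPresentedChartedFamilies hB
    (blochPresentedChartedFamilies_of_hc_cm_of_cmDense_of_existsBlochDense hCM (cmDenseMumfordTateFamilies_of_deligne1982 hD)
      (existsBlochDense_of_uniformBlochLift hL))

/-- **SQ-9′ — the same with the (F1)-cycle form as the hypothesis of record** (the weakest `HC_CM`-load-bearing cycle form; by §4 it is,
like every cycle form, a case of `HC_AV` — RED-GS GS-14):
`HC_CM ∧ [Deligne 1982, dense] ∧ [Bloch 7.4] ∧ ExistsBlochCMAnchorDense ⟹ HC_AV ∧ HodgeWeilType`. [cite: Deligne1982HodgeCycles, Prop. 6.1]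
[cite: Bloch1972Semiregularity, Thm. (7.4)] -/
theorem hc_av_of_hc_cm_of_deligne1982_of_blochSpread_of_existsBlochDense (hCM : Theses.RankFourFaces.CMAbelianHodge)
    (hD : deligne1982_cmDenseMumfordTateFamilies) (hB : ∀ m p : ℕ, BlochSemiregularSpread m p) (hL : ExistsBlochCMAnchorDense) :
    Theses.PadicSemiregularLift.HodgeAbelianVarieties ∧ HodgeWeilType :=
  have h := hc_av_of_blochSpread_of_blochPresentedChartedFamilies hB
    (blochPresentedChartedFamilies_of_hc_cm_of_cmDense_of_existsBlochDense hCM (cmDenseMumfordTateFamilies_of_deligne1982 hD) hL)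
  ⟨h, hodgeAbelianVarieties_iff_hodgeWeilType.1 h⟩


/-! ### §4 Converse (RED-GS GS-14 for the (F1)-cycle form): `HC_AV ⟹ ExistsBlochCMAnchorDense` -/

/-- **`HC_AV ⟹ ExistsBlochCMAnchorDense`** (position theorem; `HC_AV` is the HYPOTHESIS): on a CM-dense family with abelian charts everywhere,
`HC_AV` makes `W` algebraic on every fibre (chart by chart, `mem_algebraicClasses_map_iff_of_iso`), so at ANY CM fibre (one exists by density on the
non-empty `S(ℂ)`, `Motives.ComplexPoints_nonempty_of_smooth`) the correction `H := W` with the model `Iso.refl` closes the first disjunct. Hence,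
with SQ-8/SQ-9′, modulo {Deligne 1982 6.1 dense, Bloch 7.4}: `(HC_CM ∧ ExistsBlochCMAnchorDense) ↔ HC_AV`. [cite: Deligne1982HodgeCycles, §6 p. 61]
[cite: Bloch1972Semiregularity, Remark (7.5)] -/
theorem existsBlochCMAnchorDense_of_hc_av (h : Theses.PadicSemiregularLift.HodgeAbelianVarieties) : ExistsBlochCMAnchorDense := by
  intro 𝒳 S f n p W hf hq𝒳 hqS hirr hsm hab hW hD _
  haveI := hsm
  haveI := hirr
  haveI : Nonempty (ComplexPoints S) := ComplexPoints_nonempty_of_smooth S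
  obtain ⟨s₁, hs₁⟩ := hD.nonempty
  have hWalg : ∀ t : ComplexPoints S, IsRationalClass (complexBetti.map (fiberι f t) (2 * p) W) ∧
      complexBetti.map (fiberι f t) (2 * p) W ∈ algebraicClasses (fiberOver f t) p := by
    intro t
    obtain ⟨B, hBdim, ⟨iB⟩⟩ := hab t
    refine ⟨(hW t).1, (mem_algebraicClasses_map_iff_of_iso iB).1 ((h B).2 p _ ?_ ?_)⟩
    · exact (isRationalClass_map_iff_of_iso iB).2 (hW t).1
    · rw [hBdim]
      exact (isOfHodgeType_map_iff_of_iso iB).2 (hW t).2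
  exact ⟨s₁, hs₁, W, fiberOver f s₁, Iso.refl _, hWalg, Or.inl (by rw [sub_self, map_zero])⟩

/-- **The (F1)-cycle sandwich**: modulo {Deligne 1982 Prop. 6.1 (dense form), Bloch 7.4}, `(HC_CM ∧ ExistsBlochCMAnchorDense) ↔ HC_AV`.
[cite: Deligne1982HodgeCycles, Prop. 6.1] [cite: Bloch1972Semiregularity, Thm. (7.4)] -/
theorem existsBlochCMAnchorDense_sandwich (hD : deligne1982_cmDenseMumfordTateFamilies) (hB : ∀ m p : ℕ, BlochSemiregularSpread m p) :
    (Theses.RankFourFaces.CMAbelianHodge ∧ ExistsBlochCMAnchorDense) ↔ Theses.PadicSemiregularLift.HodgeAbelianVarieties :=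
  ⟨fun h' ↦ (hc_av_of_hc_cm_of_deligne1982_of_blochSpread_of_existsBlochDense h'.1 hD hB h'.2).1,
    fun h' ↦ ⟨Ring2.Deform.HC_CM_of_HC_AV h', existsBlochCMAnchorDense_of_hc_av h'⟩⟩

/-! ## Audit: nothing is decided here — one new `@[conjecture] def` ((F1)-cycle) and implications between named typed statements; axiom closures standard. -/

#print axioms Summit.Ventures.HSemireg.GeneralStructure.blochPresentedChartedFamilies_of_hc_cm_of_cmAnchoredFamilies_of_catanese_of_uniformBlochLift

end Summit.Ventures.HSemireg.GeneralStructure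

end
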